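import Literature.AnabelianGeometry.EtaleTheta.Discharge.Sec2RigidityAtModelTate
import Literature.AnabelianGeometry.EtaleTheta.SettingModelTateDoubleUnderlineEtaRes
import Literature.AnabelianGeometry.EtaleTheta.SettingModelTateCyclotomes
import Literature.AnabelianGeometry.EtaleTheta.SettingModelTateKummerData
import Literature.AnabelianGeometry.EtaleTheta.EtaleThetaDataOfClass
import HarnessLib

/-!
# [EtTh] §2 over §1 AT THE STAGE-2 RECORD `ThetaSetting.modelχq p i j hj` (Tate instance `modelTate p = modelχq p 1 2`):
# THE MONO-THETA ENVIRONMENT, TOWER AND RIGIDITY DATA OF RECORD — Def. 2.13 / Cor. 2.18 (iii)/(iv) binder-free, and the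
# `RigidData` rows (Prop. 2.12, 2.14 (i)/(iii), Cor. 2.18 (iii)/(iv), 2.19 (i)) modulo Prop. 1.5 (iii) ALONE (proof-only)

Mochizuki, *The Étale Theta Function and its Frobenioid-theoretic Manifestations* [EtTh], Publ. RIMS **45** (2009), §2:
Def. 2.13 PRIMS PDF p. 47, Prop. 2.12 p. 45, Prop. 2.14 p. 49, Cor. 2.18 pp. 59–63, Cor. 2.19 p. 64; §1 Prop. 1.5 (iii)
p. 23, Def. 2.5 (i) p. 39, Def. 2.7 p. 41 [cite: MochizukiEtTh2009, Def 2.13 p.47].  Cell `abc-iut`, layer L2, seat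
abc-iut-L2-t8 (gen 6; owner of the §1 → §2 merge adapter `C.thetaEnvData` / `C.thetaEnvTower` / `C.rigidData`,
`ThetaEnvOfSetting` / `TowerOfSetting` / `RigidOfSetting`, and of `CyclotomeMod`); R78 cluster (integrator abc-iut-L6-d6)
row #5, STAGE-2 twin of this seat's `SettingModelChiThetaEnv` (p441967).  PROOF-ONLY: no definition, no instance, no
notation, no new named fact; nothing of another seat is edited or restated — every input is consumed BY NAME.

STATE OF RECORD.  abc-iut-f-149 (gen 3)'s `Discharge/Sec2RigidityAtModelTate` proved the §2 rows of `ThetaRigidity.lean` /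
`MonoThetaEnv.lean` AT THE STAGE-2 RECORD for EVERY `(E, C, μ / τ)` (and, for the `RigidData` rows, every `h15`, `L`),
with the five model-side binders discharged (`IsEtThOrigin`, `hYcl` — abc-iut-L2-t5; `Sec2Hyps` / `Compat` — abc-iut-L2-d1;
temp-slimness — abc-iut-w5-d249 / L2-t5; `IsOpenMap aug`).  The construction data now EXIST at stage 2:
* the class of record `η̈♯ = etaDdχq p i j hj` (abc-iut-L2-t6, F7q `SettingModelTateZClass`) and, for EVERY étale-theta
  datum `E_K := K.etaleThetaDataOfClass (etaDdχq …)` carrying it over ANY stage-2 Kummer datum `K` (abc-iut-w5-d171's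
  `kummerDataχq` F6q, abc-iut-L6-d5's / abc-iut-L2-t6's section data `(kummerCoreχq …).toKummerDataOfSection s …`), the choice
  `X̲̲ := E_K.doubleUnderlineχqOfEtaRes … (eta_res_etaDdχq …)` with `Π^tp_X̲̲ = Huuχq p i j l hl = dUU l ⋊ G_{ℚ_p}`
  (abc-iut-L2-d1, `SettingModelTateDoubleUnderline` + `SettingModelTateDoubleUnderlineEtaRes`: `eta_res_etaDdχq`);
* the cyclotome identifications `μ` / towers `τ` of the stage-2 model — this seat's `modelχq_nonempty_cyclotomeMod` /
  `modelχq_nonempty_cyclotomeTower` (`SettingModelTateCyclotomes`, p437770).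

THIS FILE.  §1 (h15-FREE, NO binder beyond the Kummer datum `K`): the mono-theta environment OF RECORD
`X̲̲.thetaEnvData μ compat sec2Hyps : ThetaEnvData N` has `Π_X̲̲ = Huuχq` and satisfies Cor. 2.18 (iii) (F-0636/F-0637);
the tower OF RECORD satisfies Cor. 2.18 (iv), reduction (F-0648), and Cor. 2.18 (iii) at every level; BINDER-FREE census
forms at `E₀ := (kummerDataχq p i j hj).etaleThetaDataOfClass (etaDdχq p i j hj)` (`∃ E C μ / τ, E.etaDd = η̈♯ ∧ Prop13 E ∧ …`).
§2 (modulo Prop. 1.5 (iii) ALONE): for every `h15 : Prop15iii E_K compat` the rigidity data OF RECORD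
`X̲̲.rigidData μ compat sec2Hyps h15 L∅` (empty cusp labelling `L∅`) satisfy Prop. 2.12 (i)/(ii) (F-1920/F-0630),
Prop. 2.14 (i) (F-0631), Cor. 2.18 (iv) fibre (F-0624), Cor. 2.18 (iii) (F-0622/F-0623), Prop. 2.14 (iii) mono/bi at the empty
labelling (F-0634/F-0633), and Cor. 2.19 (i) (subquotients / cyclotomic rigidity) modulo Cor. 2.18 (i) — `h15` is the
ONLY binder left, and it is abc-iut-L2-t6's F7q theorem at the Tate instance `(i, j) = (1, 2)` for section data
(`prop15iii_etaleThetaDataOfClass_etaDdχq`, `SettingModelTateDeckDisplay*`): the closed instance is the sequel of this file.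
HONEST LABEL: `modelχq` is a SEMI-SYNTHETIC model of the typed §1 interface (not the tempered `π₁` of a curve) —
consistency / joint-satisfiability evidence only; nothing of [EtTh] asserted; no side taken on [IUTchIII] Cor. 3.12;
typed ≠ proved; a FACT row is an assumption label, not an endorsement.
-/

noncomputable section

namespace Literature.AnabelianGeometry.EtaleTheta.SettingModel

open Literature.AnabelianGeometry.SemiGraphs

variable (p : ℕ) [Fact p.Prime] (i j : ℤ) (hj : Even j) (l : ℕ+) (hl : Odd (l : ℕ))
  (K : (ThetaSetting.modelχq p i j hj).KummerData)
  {N : ℕ+} (μ : (ThetaSetting.modelχq p i j hj).CyclotomeMod l N)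
  {Es : Set ℕ+} (τ : (ThetaSetting.modelχq p i j hj).CyclotomeTower l Es)

/-! ## §1. The mono-theta environment and tower OF RECORD at stage 2 (Def. 2.13; h15-free rows) -/

/-- **`Π_X̲̲` of the stage-2 mono-theta environment of record is `Huuχq p i j l hl = dUU l ⋊ G_{ℚ_p}`** (Def. 2.13's
"`Π^tp_X̲̲`" at the stage-2 model's own choice `X̲̲`; definitional). [cite: MochizukiEtTh2009, Def 2.13 p.47] -/
theorem thetaEnvData_modelχqSec_PiX :
    (((K.etaleThetaDataOfClass (etaDdχq p i j hj)).doubleUnderlineχqOfEtaRes p i j l hl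
          (eta_res_etaDdχq p i j hj l hl)).thetaEnvData μ (compat_modelχq p i j hj)
        (ThetaSetting.modelχq_sec2Hyps p i j hj)).PiX = Huuχq p i j l hl :=
  rfl

/-- **Cor. 2.18 (iii) for the stage-2 mono-theta environment of record and Cor. 2.18 (iv) (reduction) for the stage-2
tower of record — NO binder beyond the Kummer datum `K`** (F-0636 / F-0637 / F-0648; abc-iut-f-149's `thetaEnvData_sec2_rows_modelχq_holds`
at the record `X̲̲`). [cite: MochizukiEtTh2009, Cor 2.18 (iii) p.61] -/
theorem thetaEnvData_modelχqSec_sec2_rows :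
    (Literature.AnabelianGeometry.EtaleTheta.ThetaEnvData.Cor218_iii_PiX
        (((K.etaleThetaDataOfClass (etaDdχq p i j hj)).doubleUnderlineχqOfEtaRes p i j l hl
          (eta_res_etaDdχq p i j hj l hl)).thetaEnvData μ (compat_modelχq p i j hj)
          (ThetaSetting.modelχq_sec2Hyps p i j hj)) ∧
      Literature.AnabelianGeometry.EtaleTheta.ThetaEnvData.Cor218_iii_quotient
        (((K.etaleThetaDataOfClass (etaDdχq p i j hj)).doubleUnderlineχqOfEtaRes p i j l hl
          (eta_res_etaDdχq p i j hj l hl)).thetaEnvData μ (compat_modelχq p i j hj)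
          (ThetaSetting.modelχq_sec2Hyps p i j hj))) ∧
    Literature.AnabelianGeometry.EtaleTheta.ThetaEnvTower.Cor218_iv_reduction
        (((K.etaleThetaDataOfClass (etaDdχq p i j hj)).doubleUnderlineχqOfEtaRes p i j l hl
          (eta_res_etaDdχq p i j hj l hl)).thetaEnvTower τ (compat_modelχq p i j hj)
          (ThetaSetting.modelχq_sec2Hyps p i j hj)) :=
  thetaEnvData_sec2_rows_modelχq_holds p i j hj ((K.etaleThetaDataOfClass (etaDdχq p i j hj)).doubleUnderlineχqOfEtaRes p i j l hl
          (eta_res_etaDdχq p i j hj l hl)) μ τ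

/-- **Cor. 2.18 (iii) at every level of the stage-2 tower of record, NO binder beyond the Kummer datum `K`.**
[cite: MochizukiEtTh2009, Cor 2.18 (iii) p.61] -/
theorem thetaEnvTower_modelχqSec_level_cor218_iii (M : Es) :
    Literature.AnabelianGeometry.EtaleTheta.ThetaEnvData.Cor218_iii_PiX
        ((((K.etaleThetaDataOfClass (etaDdχq p i j hj)).doubleUnderlineχqOfEtaRes p i j l hl
          (eta_res_etaDdχq p i j hj l hl)).thetaEnvTower τ (compat_modelχq p i j hj)
          (ThetaSetting.modelχq_sec2Hyps p i j hj)).level M) ∧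
      Literature.AnabelianGeometry.EtaleTheta.ThetaEnvData.Cor218_iii_quotient
        ((((K.etaleThetaDataOfClass (etaDdχq p i j hj)).doubleUnderlineχqOfEtaRes p i j l hl
          (eta_res_etaDdχq p i j hj l hl)).thetaEnvTower τ (compat_modelχq p i j hj)
          (ThetaSetting.modelχq_sec2Hyps p i j hj)).level M) :=
  thetaEnvTower_level_cor218_iii_modelχq p i j hj ((K.etaleThetaDataOfClass (etaDdχq p i j hj)).doubleUnderlineχqOfEtaRes p i j l hl
          (eta_res_etaDdχq p i j hj l hl)) τ _ _ M

include hl in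
/-- **BINDER-FREE CENSUS, level `N`, at the stage-2 record**: there EXIST an étale-theta datum over `modelχq p i j hj`
carrying the class of record `η̈♯` and Prop. 1.3, a choice `X̲̲` for it with `Π^tp_X̲̲ = Huuχq`, and a cyclotome
identification whose mono-theta environment satisfies both clauses of Cor. 2.18 (iii) — witnesses
`(kummerDataχq p i j hj).etaleThetaDataOfClass (etaDdχq p i j hj)` (abc-iut-w5-d171 F6q + abc-iut-L2-t6 F7q),
`doubleUnderlineχqOfEtaRes` + `eta_res_etaDdχq` (abc-iut-L2-d1), `modelχq_nonempty_cyclotomeMod` (this seat).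
[cite: MochizukiEtTh2009, Cor 2.18 (iii) p.61] -/
theorem exists_thetaEnvData_cor218_iii_modelχq (N : ℕ+) :
    ∃ (E : (ThetaSetting.modelχq p i j hj).EtaleThetaData) (C : E.DoubleUnderline l)
      (μ : (ThetaSetting.modelχq p i j hj).CyclotomeMod l N),
      E.etaDd = etaDdχq p i j hj ∧ ThetaSetting.Prop13 E ∧ C.Huu = Huuχq p i j l hl ∧
        Literature.AnabelianGeometry.EtaleTheta.ThetaEnvData.Cor218_iii_PiX
            (C.thetaEnvData μ (compat_modelχq p i j hj) (ThetaSetting.modelχq_sec2Hyps p i j hj)) ∧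
          Literature.AnabelianGeometry.EtaleTheta.ThetaEnvData.Cor218_iii_quotient
            (C.thetaEnvData μ (compat_modelχq p i j hj) (ThetaSetting.modelχq_sec2Hyps p i j hj)) := by
  obtain ⟨μ⟩ := modelχq_nonempty_cyclotomeMod p i j hj l.pos N
  exact ⟨(kummerDataχq p i j hj).etaleThetaDataOfClass (etaDdχq p i j hj),
    ((kummerDataχq p i j hj).etaleThetaDataOfClass (etaDdχq p i j hj)).doubleUnderlineχqOfEtaRes p i j l hl
      (eta_res_etaDdχq p i j hj l hl), μ, rfl,
    ThetaSetting.KummerData.prop13_etaleThetaDataOfClass _ _, rfl,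
    thetaEnvData_cor218_iii_modelχq p i j hj _ μ _ _⟩

include hl in
/-- **BINDER-FREE CENSUS, tower form, at the stage-2 record**: over every admissible index chain `E ∋ 1` there EXIST
`E`, `X̲̲` as above and a compatible cyclotome tower whose tower of mono-theta environments satisfies Cor. 2.18 (iv),
reduction clause, and Cor. 2.18 (iii) at every level. [cite: MochizukiEtTh2009, Cor 2.18 (iv) p.61] -/
theorem exists_thetaEnvTower_cor218_iii_iv_modelχq (one_mem : (1 : ℕ+) ∈ Es)
    (cofinal : ∀ n : ℕ+, ∃ M ∈ Es, n ∣ M) (total : ∀ M ∈ Es, ∀ M' ∈ Es, M ∣ M' ∨ M' ∣ M) :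
    ∃ (E : (ThetaSetting.modelχq p i j hj).EtaleThetaData) (C : E.DoubleUnderline l)
      (τ : (ThetaSetting.modelχq p i j hj).CyclotomeTower l Es),
      E.etaDd = etaDdχq p i j hj ∧ ThetaSetting.Prop13 E ∧ C.Huu = Huuχq p i j l hl ∧
        Literature.AnabelianGeometry.EtaleTheta.ThetaEnvTower.Cor218_iv_reduction
            (C.thetaEnvTower τ (compat_modelχq p i j hj) (ThetaSetting.modelχq_sec2Hyps p i j hj)) ∧
          ∀ M : Es,
            Literature.AnabelianGeometry.EtaleTheta.ThetaEnvData.Cor218_iii_PiX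
                ((C.thetaEnvTower τ (compat_modelχq p i j hj) (ThetaSetting.modelχq_sec2Hyps p i j hj)).level M) ∧
              Literature.AnabelianGeometry.EtaleTheta.ThetaEnvData.Cor218_iii_quotient
                ((C.thetaEnvTower τ (compat_modelχq p i j hj) (ThetaSetting.modelχq_sec2Hyps p i j hj)).level M) := by
  obtain ⟨τ⟩ := modelχq_nonempty_cyclotomeTower p i j hj l.pos one_mem cofinal total
  exact ⟨(kummerDataχq p i j hj).etaleThetaDataOfClass (etaDdχq p i j hj),
    ((kummerDataχq p i j hj).etaleThetaDataOfClass (etaDdχq p i j hj)).doubleUnderlineχqOfEtaRes p i j l hl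
      (eta_res_etaDdχq p i j hj l hl), τ, rfl,
    ThetaSetting.KummerData.prop13_etaleThetaDataOfClass _ _, rfl,
    cor218_iv_reduction_modelχq p i j hj _ τ _ _, fun M => thetaEnvTower_level_cor218_iii_modelχq p i j hj _ τ _ _ M⟩

/-! ## §2. The rigidity data OF RECORD at stage 2 (empty cusp labelling), modulo Prop. 1.5 (iii) ALONE -/

/-- **The `RigidData` rows for the stage-2 rigidity data of record, `h15` the ONLY binder**: for every étale-theta datum
carrying `η̈♯`, every `h15 : Prop15iii E compat`, every level `μ`, the data
`X̲̲.rigidData μ compat sec2Hyps h15 L∅` (empty cusp labelling) satisfy Prop. 2.12 (i), (ii), Prop. 2.14 (i), the fibre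
clause of Cor. 2.18 (iv), both clauses of Cor. 2.18 (iii) (abc-iut-f-149's `rigidData_sec2_rows_modelχq_holds`) AND
Prop. 2.14 (iii) mono / bi at the empty `Y`-labelling (`rigidData_prop214_iii_dichotomy_modelχq`, first half).
[cite: MochizukiEtTh2009, Prop 2.14 (i) p.49] -/
theorem rigidData_modelχqSec_sec2_rows (h15 : ThetaSetting.Prop15iii (K.etaleThetaDataOfClass (etaDdχq p i j hj)) (compat_modelχq p i j hj)) :
    Literature.AnabelianGeometry.EtaleTheta.RigidData.Prop212_i
        (((K.etaleThetaDataOfClass (etaDdχq p i j hj)).doubleUnderlineχqOfEtaRes p i j l hl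
          (eta_res_etaDdχq p i j hj l hl)).rigidData μ (compat_modelχq p i j hj)
          (ThetaSetting.modelχq_sec2Hyps p i j hj) h15 ⟨fun _ => ∅, fun _ => ∅, fun _ => rfl⟩) ∧
      Literature.AnabelianGeometry.EtaleTheta.RigidData.Prop212_ii
        (((K.etaleThetaDataOfClass (etaDdχq p i j hj)).doubleUnderlineχqOfEtaRes p i j l hl
          (eta_res_etaDdχq p i j hj l hl)).rigidData μ (compat_modelχq p i j hj)
          (ThetaSetting.modelχq_sec2Hyps p i j hj) h15 ⟨fun _ => ∅, fun _ => ∅, fun _ => rfl⟩) ∧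
      Literature.AnabelianGeometry.EtaleTheta.RigidData.Prop214_i
        (((K.etaleThetaDataOfClass (etaDdχq p i j hj)).doubleUnderlineχqOfEtaRes p i j l hl
          (eta_res_etaDdχq p i j hj l hl)).rigidData μ (compat_modelχq p i j hj)
          (ThetaSetting.modelχq_sec2Hyps p i j hj) h15 ⟨fun _ => ∅, fun _ => ∅, fun _ => rfl⟩) ∧
      Literature.AnabelianGeometry.EtaleTheta.RigidData.Cor218_iv_fibre
        (((K.etaleThetaDataOfClass (etaDdχq p i j hj)).doubleUnderlineχqOfEtaRes p i j l hl
          (eta_res_etaDdχq p i j hj l hl)).rigidData μ (compat_modelχq p i j hj)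
          (ThetaSetting.modelχq_sec2Hyps p i j hj) h15 ⟨fun _ => ∅, fun _ => ∅, fun _ => rfl⟩) ∧
      Literature.AnabelianGeometry.EtaleTheta.RigidData.Cor218_iii_PiX
        (((K.etaleThetaDataOfClass (etaDdχq p i j hj)).doubleUnderlineχqOfEtaRes p i j l hl
          (eta_res_etaDdχq p i j hj l hl)).rigidData μ (compat_modelχq p i j hj)
          (ThetaSetting.modelχq_sec2Hyps p i j hj) h15 ⟨fun _ => ∅, fun _ => ∅, fun _ => rfl⟩) ∧
      Literature.AnabelianGeometry.EtaleTheta.RigidData.Cor218_iii_quotient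
        (((K.etaleThetaDataOfClass (etaDdχq p i j hj)).doubleUnderlineχqOfEtaRes p i j l hl
          (eta_res_etaDdχq p i j hj l hl)).rigidData μ (compat_modelχq p i j hj)
          (ThetaSetting.modelχq_sec2Hyps p i j hj) h15 ⟨fun _ => ∅, fun _ => ∅, fun _ => rfl⟩) ∧
      Literature.AnabelianGeometry.EtaleTheta.RigidData.Prop214_iii_mono
        (((K.etaleThetaDataOfClass (etaDdχq p i j hj)).doubleUnderlineχqOfEtaRes p i j l hl
          (eta_res_etaDdχq p i j hj l hl)).rigidData μ (compat_modelχq p i j hj)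
          (ThetaSetting.modelχq_sec2Hyps p i j hj) h15 ⟨fun _ => ∅, fun _ => ∅, fun _ => rfl⟩) ∧
      Literature.AnabelianGeometry.EtaleTheta.RigidData.Prop214_iii_bi
        (((K.etaleThetaDataOfClass (etaDdχq p i j hj)).doubleUnderlineχqOfEtaRes p i j l hl
          (eta_res_etaDdχq p i j hj l hl)).rigidData μ (compat_modelχq p i j hj)
          (ThetaSetting.modelχq_sec2Hyps p i j hj) h15 ⟨fun _ => ∅, fun _ => ∅, fun _ => rfl⟩) := by
  obtain ⟨h1, h2, h3, h4, h5, h6⟩ :=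
    rigidData_sec2_rows_modelχq_holds p i j hj ((K.etaleThetaDataOfClass (etaDdχq p i j hj)).doubleUnderlineχqOfEtaRes p i j l hl
          (eta_res_etaDdχq p i j hj l hl)) μ h15
      ⟨fun _ => ∅, fun _ => ∅, fun _ => rfl⟩
  obtain ⟨⟨h7, h8⟩, -, -⟩ :=
    rigidData_prop214_iii_dichotomy_modelχq p i j hj ((K.etaleThetaDataOfClass (etaDdχq p i j hj)).doubleUnderlineχqOfEtaRes p i j l hl
          (eta_res_etaDdχq p i j hj l hl)) μ _ _ h15
  exact ⟨h1, h2, h3, h4, h5, h6, h7, h8⟩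

/-- **Cor. 2.19 (i) for the stage-2 rigidity data of record** — subquotient preservation and cyclotomic rigidity of the
model mono-theta environment — modulo Prop. 1.5 (iii) and Cor. 2.18 (i) at that data ONLY (abc-iut-f-149's
`cor219_i_subquotients_modelχq` / `cor219_i_splittings_modelχq`). [cite: MochizukiEtTh2009, Cor 2.19 (i) p.64] -/
theorem rigidData_modelχqSec_cor219_i (h15 : ThetaSetting.Prop15iii (K.etaleThetaDataOfClass (etaDdχq p i j hj)) (compat_modelχq p i j hj))
    (h218i : (((K.etaleThetaDataOfClass (etaDdχq p i j hj)).doubleUnderlineχqOfEtaRes p i j l hl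
          (eta_res_etaDdχq p i j hj l hl)).rigidData μ (compat_modelχq p i j hj)
      (ThetaSetting.modelχq_sec2Hyps p i j hj) h15 ⟨fun _ => ∅, fun _ => ∅, fun _ => rfl⟩).Cor218_i) :
    Literature.AnabelianGeometry.EtaleTheta.RigidData.Cor219_i_subquotients
        (((K.etaleThetaDataOfClass (etaDdχq p i j hj)).doubleUnderlineχqOfEtaRes p i j l hl
          (eta_res_etaDdχq p i j hj l hl)).rigidData μ (compat_modelχq p i j hj)
          (ThetaSetting.modelχq_sec2Hyps p i j hj) h15 ⟨fun _ => ∅, fun _ => ∅, fun _ => rfl⟩) ∧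
      Literature.AnabelianGeometry.EtaleTheta.RigidData.Cor219_i_splittings
        (((K.etaleThetaDataOfClass (etaDdχq p i j hj)).doubleUnderlineχqOfEtaRes p i j l hl
          (eta_res_etaDdχq p i j hj l hl)).rigidData μ (compat_modelχq p i j hj)
          (ThetaSetting.modelχq_sec2Hyps p i j hj) h15 ⟨fun _ => ∅, fun _ => ∅, fun _ => rfl⟩) :=
  ⟨cor219_i_subquotients_modelχq p i j hj _ μ _ _ h15 _ h218i, cor219_i_splittings_modelχq p i j hj _ μ _ _ h15 _ h218i⟩

/-- **Cor. 2.19 (ii) (discrete rigidity) for the stage-2 tower of record**, modulo Prop. 1.5 (iii) and the level-wise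
Cor. 2.18 (iv) surjectivity at the rigidity data of record (abc-iut-f-149's `cor219_ii_modelχq_of_lift`).
[cite: MochizukiEtTh2009, Cor 2.19 (ii) p.64] -/
theorem thetaEnvTower_modelχqSec_cor219_ii_of_lift (h15 : ThetaSetting.Prop15iii (K.etaleThetaDataOfClass (etaDdχq p i j hj)) (compat_modelχq p i j hj))
    (hlift : ∀ M : Es, (((K.etaleThetaDataOfClass (etaDdχq p i j hj)).doubleUnderlineχqOfEtaRes p i j l hl
          (eta_res_etaDdχq p i j hj l hl)).rigidData (τ.mod M) (compat_modelχq p i j hj)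
      (ThetaSetting.modelχq_sec2Hyps p i j hj) h15 ⟨fun _ => ∅, fun _ => ∅, fun _ => rfl⟩).Cor218_iv_surjective) :
    Literature.AnabelianGeometry.EtaleTheta.ThetaEnvTower.Cor219_ii
      (((K.etaleThetaDataOfClass (etaDdχq p i j hj)).doubleUnderlineχqOfEtaRes p i j l hl
          (eta_res_etaDdχq p i j hj l hl)).thetaEnvTower τ (compat_modelχq p i j hj)
        (ThetaSetting.modelχq_sec2Hyps p i j hj)) :=
  cor219_ii_modelχq_of_lift p i j hj _ τ _ _ h15 _ hlift

include hl in
/-- **CENSUS modulo Prop. 1.5 (iii) ALONE, at the stage-2 record**: if SOME étale-theta datum carrying `η̈♯` satisfies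
Prop. 1.5 (iii) (abc-iut-L2-t6's F7q theorem supplies this at the Tate instance), then there EXIST `E`, `X̲̲`, `μ`, `h15`, `L` with `E.etaDd = η̈♯`, `Π^tp_X̲̲ = Huuχq` and the EIGHT `RigidData` rows above TRUE at the
rigidity data of record (empty labelling).
[cite: MochizukiEtTh2009, Prop 2.14 (i) p.49] -/
theorem exists_rigidData_sec2_rows_modelχq_of_prop15iii (N : ℕ+)
    (h : ∃ K : (ThetaSetting.modelχq p i j hj).KummerData,
      ThetaSetting.Prop15iii (K.etaleThetaDataOfClass (etaDdχq p i j hj)) (compat_modelχq p i j hj)) :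
    ∃ (E : (ThetaSetting.modelχq p i j hj).EtaleThetaData) (C : E.DoubleUnderline l)
      (μ : (ThetaSetting.modelχq p i j hj).CyclotomeMod l N) (h15 : ThetaSetting.Prop15iii E (compat_modelχq p i j hj))
      (L : C.CuspLabels),
      E.etaDd = etaDdχq p i j hj ∧ C.Huu = Huuχq p i j l hl ∧
      Literature.AnabelianGeometry.EtaleTheta.RigidData.Prop212_i
          (C.rigidData μ (compat_modelχq p i j hj) (ThetaSetting.modelχq_sec2Hyps p i j hj) h15 L) ∧
      Literature.AnabelianGeometry.EtaleTheta.RigidData.Prop212_ii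
          (C.rigidData μ (compat_modelχq p i j hj) (ThetaSetting.modelχq_sec2Hyps p i j hj) h15 L) ∧
      Literature.AnabelianGeometry.EtaleTheta.RigidData.Prop214_i
          (C.rigidData μ (compat_modelχq p i j hj) (ThetaSetting.modelχq_sec2Hyps p i j hj) h15 L) ∧
      Literature.AnabelianGeometry.EtaleTheta.RigidData.Cor218_iv_fibre
          (C.rigidData μ (compat_modelχq p i j hj) (ThetaSetting.modelχq_sec2Hyps p i j hj) h15 L) ∧
      Literature.AnabelianGeometry.EtaleTheta.RigidData.Cor218_iii_PiX
          (C.rigidData μ (compat_modelχq p i j hj) (ThetaSetting.modelχq_sec2Hyps p i j hj) h15 L) ∧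
      Literature.AnabelianGeometry.EtaleTheta.RigidData.Cor218_iii_quotient
          (C.rigidData μ (compat_modelχq p i j hj) (ThetaSetting.modelχq_sec2Hyps p i j hj) h15 L) ∧
      Literature.AnabelianGeometry.EtaleTheta.RigidData.Prop214_iii_mono
          (C.rigidData μ (compat_modelχq p i j hj) (ThetaSetting.modelχq_sec2Hyps p i j hj) h15 L) ∧
      Literature.AnabelianGeometry.EtaleTheta.RigidData.Prop214_iii_bi
          (C.rigidData μ (compat_modelχq p i j hj) (ThetaSetting.modelχq_sec2Hyps p i j hj) h15 L) := by
  obtain ⟨K, h15⟩ := h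
  obtain ⟨μ⟩ := modelχq_nonempty_cyclotomeMod p i j hj l.pos N
  exact ⟨_, (K.etaleThetaDataOfClass (etaDdχq p i j hj)).doubleUnderlineχqOfEtaRes p i j l hl
      (eta_res_etaDdχq p i j hj l hl), μ, h15, _, rfl, rfl, rigidData_modelχqSec_sec2_rows p i j hj l hl K μ h15⟩

end Literature.AnabelianGeometry.EtaleTheta.SettingModel

end
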